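import Literature.Probability.RandomPlanarGeometry.Curve
import Mathlib.MeasureTheory.Measure.Lebesgue.Basic
import HarnessLib

/-!
# Crux `NestingRigidity`, line `pinch-resampling` (v3), stub S9 helper: no far backtrack of shadows

Crux `Summit.CriticalPhenomena.CardyFormulaZ2.Theses.CardyMagicRigidity.NestingRigidity`
(stmt-CriticalPhenomena-4835), line `pinch-resampling` v3, stub S9 `stub_noNeckRigidity`.  This file is the
KEY LEMMA of the proof of `NoNeckRigidity` (docstring of that definition in
`CardyMagicRigidityPinchResamplingDefsV3`), in a slightly sharper form and with the neck-freeness hypotheses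
spelled out (`∀ s t, dist (a s) (a t) ≤ r → diam (a '' uIcc s t) ≤ θ`, definitionally `NeckFree r θ a`):

**No far backtrack** (`diam_image_Icc_le_of_backtrack`, registered anchor).  Let `2ε < r`, `0 ≤ ζ`, `a` and `b`
neck-free at scales `(r, θ)`, `b` in the closed `ε`-tube of `a` (H1), every point of `a` within `ε` of `b` except
`ζ`-near the endpoints of `a` (H2), and `b 0` within `ε` of a point `a s₀` with `diam a[0, s₀] ≤ θ` (A0).  If at
times `t₁ ≤ t₂` the curve `b` is `ε`-close to `a p` and then to `a q` with `q ≤ p` (the shadow moved BACKWARDS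
along `a`), then `diam a[q, p] ≤ 10 θ + 4 ε + 4 ζ`.

Proof (colouring / connectedness).  If not, some `s ∈ [q, p]` has `a s` farther than `2θ + 2ε` from `a p`, than
`θ` from `a q` and than `θ + ζ` from `a 0`, `a 1` (`exists_far_of_lt_diam`: a connected arc of diameter `> 2 Σ ρᵢ`
is not covered by four balls of radii `ρᵢ` — intermediate values of `dist (a ·) (a u)` and Lebesgue measure).
On the interval `K = {k : diam a[s, k] ≤ θ}` every point is `ε`-visited by `b` (H2), never both at a time `≤ t₁`
and at a time `≥ t₁` (two visits are `2ε ≤ r`-close on `b`, so `b t₁`, hence `a p`, would be close to `a s`);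
the two closed classes cover the preconnected `K`, and both are nonempty by the CHAIN lemma
`exists_mem_of_chain` (the last time in `[0, t₁]`, resp. `[t₁, t₂]`, at which `b` has a shadow on the near side
of `s` has, by continuity of `b` and the STEP property of shadows, a shadow inside `K`) — contradiction with
`isPreconnected_closed_iff`.
-/

noncomputable section

namespace Summit.CriticalPhenomena.CardyFormulaZ2.Cruxes.NestingRigidity.PinchResampling

open Set Metric MeasureTheory Literature.Probability.RandomPlanarGeometry

/-! ## Diameters of sub-arcs -/

/-- The image of any set of times under a curve is bounded (it lies in the compact trace). -/
theorem isBounded_image_curve (a : Curve ℂ) (S : Set unitInterval) : Bornology.IsBounded (a '' S) :=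
  (isCompact_range a.continuous).isBounded.subset (image_subset_range _ _)

/-- Sub-arcs have smaller diameter. -/
theorem diam_image_mono (a : Curve ℂ) {S S' : Set unitInterval} (h : S ⊆ S') :
    diam (a '' S) ≤ diam (a '' S') :=
  diam_mono (image_mono h) (isBounded_image_curve a S')

/-- Two points of a sub-arc are within its diameter. -/
theorem dist_le_diam_image (a : Curve ℂ) {S : Set unitInterval} {x y : unitInterval} (hx : x ∈ S)
    (hy : y ∈ S) : dist (a x) (a y) ≤ diam (a '' S) :=
  dist_le_diam_of_mem (isBounded_image_curve a S) (mem_image_of_mem _ hx) (mem_image_of_mem _ hy)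

/-- The projection to the first factor of a closed subset of `[0,1]²` is closed. -/
theorem isClosed_setOf_exists_mem {F : Set (unitInterval × unitInterval)} (hF : IsClosed F) :
    IsClosed {k : unitInterval | ∃ τ, (k, τ) ∈ F} := by
  have h : {k : unitInterval | ∃ τ, (k, τ) ∈ F} = Prod.fst '' F := by
    ext k
    simp only [mem_setOf_eq, mem_image, Prod.exists, exists_and_right, exists_eq_right]
  rw [h]
  exact (hF.isCompact.image continuous_fst).isClosed

/-- The pair-distance `(k, τ) ↦ dist (a k) (b τ)` is continuous. -/
theorem continuous_dist_pair (a b : Curve ℂ) :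
    Continuous fun q : unitInterval × unitInterval ↦ dist (a q.1) (b q.2) :=
  (a.continuous.comp continuous_fst).dist (b.continuous.comp continuous_snd)

/-! ## A point of a long arc far from four given points -/

/-- **A connected arc of diameter `> 2 (ρ₁ + ρ₂ + ρ₃ + ρ₄)` is not covered by four closed balls of radii
`ρ₁, …, ρ₄`**: some point of the arc is farther than `ρᵢ` from `cᵢ` for every `i`.  (Intermediate values of
`dist (f ·) (f u)` along the arc fill an interval of length `> 2 Σ ρᵢ`, while the values taken inside the ball
`i` lie in an interval of length `2 ρᵢ`; compare Lebesgue measures.) -/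
theorem exists_far_of_lt_diam (f : Curve ℂ) {p q : unitInterval} (c₁ c₂ c₃ c₄ : ℂ) {ρ₁ ρ₂ ρ₃ ρ₄ : ℝ}
    (h₁ : 0 ≤ ρ₁) (h₂ : 0 ≤ ρ₂) (h₃ : 0 ≤ ρ₃) (h₄ : 0 ≤ ρ₄)
    (hD : 2 * (ρ₁ + ρ₂ + ρ₃ + ρ₄) < diam (f '' uIcc p q)) :
    ∃ s ∈ uIcc p q, ρ₁ < dist (f s) c₁ ∧ ρ₂ < dist (f s) c₂ ∧ ρ₃ < dist (f s) c₃ ∧ ρ₄ < dist (f s) c₄ := by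
  by_contra hcon
  push Not at hcon
  have hsum : 0 ≤ 2 * (ρ₁ + ρ₂ + ρ₃ + ρ₄) := by positivity
  -- two far points `x`, `y` of the arc
  obtain ⟨x, hx, y, hy, hxy⟩ :
      ∃ x ∈ uIcc p q, ∃ y ∈ uIcc p q, 2 * (ρ₁ + ρ₂ + ρ₃ + ρ₄) < dist (f x) (f y) := by
    by_contra h
    push Not at h
    refine absurd (diam_le_of_forall_dist_le hsum ?_) (not_le.2 hD)
    rintro _ ⟨x, hx, rfl⟩ _ ⟨y, hy, rfl⟩
    exact h x hx y hy
  -- the distance to `f x` along the arc takes all values in `[0, dist (f y) (f x)]`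
  set F : unitInterval → ℝ := fun s ↦ dist (f s) (f x) with hF
  have hFc : Continuous F := f.continuous.dist continuous_const
  have hsub : uIcc x y ⊆ uIcc p q := uIcc_subset_uIcc hx hy
  have hIVT : uIcc (F x) (F y) ⊆ F '' uIcc x y := intermediate_value_uIcc hFc.continuousOn
  have hFx : F x = 0 := dist_self _
  -- the forbidden intervals
  set J : ℂ → ℝ → Set ℝ := fun c ρ ↦ Icc (dist c (f x) - ρ) (dist c (f x) + ρ) with hJ
  have hJmem : ∀ s c ρ, dist (f s) c ≤ ρ → F s ∈ J c ρ := by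
    intro s c ρ h
    have h' := abs_dist_sub_le (f s) c (f x)
    simp only [hJ, hF, mem_Icc]
    constructor <;> linarith [(abs_le.1 (h'.trans h)).1, (abs_le.1 (h'.trans h)).2]
  have hcov : Icc (0 : ℝ) (dist (f y) (f x)) ⊆ J c₁ ρ₁ ∪ J c₂ ρ₂ ∪ J c₃ ρ₃ ∪ J c₄ ρ₄ := by
    intro z hz
    have hz' : z ∈ uIcc (F x) (F y) := by
      rw [hFx, uIcc_of_le (dist_nonneg : (0 : ℝ) ≤ F y)]
      exact hz
    obtain ⟨s, hs, rfl⟩ := hIVT hz'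
    rcases le_or_gt (dist (f s) c₁) ρ₁ with hle₁ | hfar₁
    · exact Or.inl (Or.inl (Or.inl (hJmem s c₁ ρ₁ hle₁)))
    rcases le_or_gt (dist (f s) c₂) ρ₂ with hle₂ | hfar₂
    · exact Or.inl (Or.inl (Or.inr (hJmem s c₂ ρ₂ hle₂)))
    rcases le_or_gt (dist (f s) c₃) ρ₃ with hle₃ | hfar₃
    · exact Or.inl (Or.inr (hJmem s c₃ ρ₃ hle₃))
    exact Or.inr (hJmem s c₄ ρ₄ (hcon s (hsub hs) hfar₁ hfar₂ hfar₃))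
  -- compare Lebesgue measures
  have hvolJ : ∀ c ρ, volume (J c ρ) = ENNReal.ofReal (2 * ρ) := by
    intro c ρ
    simp only [hJ, Real.volume_Icc]
    congr 1
    ring
  have hvol := measure_mono (μ := volume) hcov
  rw [Real.volume_Icc, sub_zero] at hvol
  have hle : ENNReal.ofReal (dist (f y) (f x)) ≤ ENNReal.ofReal (2 * (ρ₁ + ρ₂ + ρ₃ + ρ₄)) := by
    refine hvol.trans ?_
    calc volume (J c₁ ρ₁ ∪ J c₂ ρ₂ ∪ J c₃ ρ₃ ∪ J c₄ ρ₄)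
        ≤ volume (J c₁ ρ₁) + volume (J c₂ ρ₂) + volume (J c₃ ρ₃) + volume (J c₄ ρ₄) := by
          refine (measure_union_le _ _).trans ?_
          gcongr
          refine (measure_union_le _ _).trans ?_
          gcongr
          exact measure_union_le _ _
      _ = ENNReal.ofReal (2 * (ρ₁ + ρ₂ + ρ₃ + ρ₄)) := by
          rw [hvolJ, hvolJ, hvolJ, hvolJ, ← ENNReal.ofReal_add (by positivity) (by positivity),
            ← ENNReal.ofReal_add (by positivity) (by positivity),
            ← ENNReal.ofReal_add (by positivity) (by positivity)]
          congr 1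
          ring
  have := (ENNReal.ofReal_le_ofReal_iff hsum).1 hle
  rw [dist_comm] at hxy
  linarith

/-! ## Shadows: the STEP property and the chain lemma -/

section Shadows

variable {a b : Curve ℂ} {r θ ζ ε : ℝ}

/-- **STEP**: if `a s` is `ε`-close to `b t`, `a s'` is `ε`-close to `b t'` and `dist (b t) (b t') ≤ r - 2ε`,
then `a s`, `a s'` are `r`-close, so (neck-freeness of `a`) the sub-arc `a[s, s']` has diameter `≤ θ`. -/
theorem diam_le_of_step (ha : ∀ s t : unitInterval, dist (a s) (a t) ≤ r → diam (a '' uIcc s t) ≤ θ)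
    {s s' t t' : unitInterval} (hs : dist (a s) (b t) ≤ ε) (hs' : dist (a s') (b t') ≤ ε)
    (htt : dist (b t) (b t') ≤ r - 2 * ε) : diam (a '' uIcc s s') ≤ θ := by
  refine ha s s' ?_
  calc dist (a s) (a s') ≤ dist (a s) (b t) + dist (b t) (b t') + dist (b t') (a s') :=
        dist_triangle4 _ _ _ _
    _ ≤ ε + (r - 2 * ε) + ε := by rw [dist_comm] at hs'; gcongr
    _ = r := by ring

/-- Two shadows of the same point of `b` span a sub-arc of `a` of diameter `≤ θ` (`2ε ≤ r`). -/
theorem diam_le_of_same (hr : 2 * ε < r)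
    (ha : ∀ s t : unitInterval, dist (a s) (a t) ≤ r → diam (a '' uIcc s t) ≤ θ)
    {s s' t : unitInterval} (hs : dist (a s) (b t) ≤ ε) (hs' : dist (a s') (b t) ≤ ε) :
    diam (a '' uIcc s s') ≤ θ :=
  diam_le_of_step ha hs hs' (by rw [dist_self]; linarith)

/-- **CHAIN lemma.**  Let `P` be a closed "side" of the parameter interval of `a` and `K` a set of parameters
such that `x ∈ K` whenever `P x`, `¬ P y` and `diam a[x, y] ≤ θ`.  If at time `Ta` the curve `b` has a shadow
`xa` with `P xa` and at a later time `Tb` a shadow `p` with `¬ P p`, then at some time `τ ∈ [Ta, Tb]` it has a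
shadow in `K`.  (Take the last time `τ ∈ [Ta, Tb]` with a `P`-shadow `x`: either `τ = Tb` and `x`, `p` are two
shadows of one point, or just after `τ` all shadows are non-`P` and STEP applies; either way `x ∈ K`.) -/
theorem exists_mem_of_chain (hr : 2 * ε < r)
    (ha : ∀ s t : unitInterval, dist (a s) (a t) ≤ r → diam (a '' uIcc s t) ≤ θ)
    (H1 : ∀ t, ∃ s, dist (b t) (a s) ≤ ε) (P : unitInterval → Prop) (hPc : IsClosed {x | P x})
    (K : Set unitInterval) (hPK : ∀ x y, P x → ¬ P y → diam (a '' uIcc x y) ≤ θ → x ∈ K)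
    {Ta Tb : unitInterval} (hT : Ta ≤ Tb) {xa : unitInterval} (hxa : dist (a xa) (b Ta) ≤ ε) (hPxa : P xa)
    {p : unitInterval} (hp : dist (a p) (b Tb) ≤ ε) (hPp : ¬ P p) :
    ∃ x ∈ K, ∃ τ ∈ Icc Ta Tb, dist (a x) (b τ) ≤ ε := by
  -- the closed set of times in `[Ta, Tb]` with a `P`-shadow
  set T : Set unitInterval :=
    {τ | ∃ x, (τ, x) ∈ {q : unitInterval × unitInterval | q.1 ∈ Icc Ta Tb ∧ P q.2 ∧ dist (a q.2) (b q.1) ≤ ε}}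
    with hTdef
  have hTc : IsClosed T := by
    refine isClosed_setOf_exists_mem ((isClosed_Icc.preimage continuous_fst).inter
      ((hPc.preimage continuous_snd).inter ?_))
    exact isClosed_le ((a.continuous.comp continuous_snd).dist (b.continuous.comp continuous_fst))
      continuous_const
  have hTne : T.Nonempty := ⟨Ta, xa, ⟨le_rfl, hT⟩, hPxa, hxa⟩
  obtain ⟨τs, ⟨x, ⟨hτsa, hτsb⟩, hPx, hx⟩, hτsmax⟩ := hTc.isCompact.exists_isGreatest hTne
  rcases eq_or_lt_of_le hτsb with h | h
  · -- the last `P`-shadow is at time `Tb`: `x` and `p` are two shadows of `b Tb`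
    subst h
    exact ⟨x, hPK x p hPx hPp (diam_le_of_same hr ha hx hp), τs, ⟨hτsa, le_rfl⟩, hx⟩
  · -- a slightly later time `τ'` has only non-`P` shadows; STEP
    obtain ⟨δ, hδ, hδb⟩ := Metric.continuous_iff.1 b.continuous τs (r - 2 * ε) (by linarith)
    have h' : (τs : ℝ) < Tb := h
    let τ' : unitInterval := ⟨min (Tb : ℝ) (τs + δ / 2),
      le_min Tb.2.1 (by linarith [τs.2.1]), (min_le_left _ _).trans Tb.2.2⟩
    have hτ'gt : τs < τ' := by
      show (τs : ℝ) < min (Tb : ℝ) (τs + δ / 2)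
      exact lt_min h' (by linarith)
    have hτ'le : τ' ≤ Tb := by
      show min (Tb : ℝ) (τs + δ / 2) ≤ Tb
      exact min_le_left _ _
    have hτ'dist : dist τ' τs < δ := by
      rw [Subtype.dist_eq, Real.dist_eq, abs_of_pos (sub_pos.2 (Subtype.coe_lt_coe.2 hτ'gt))]
      show min (Tb : ℝ) (τs + δ / 2) - τs < δ
      have := min_le_right (Tb : ℝ) (τs + δ / 2)
      linarith
    have hτ'T : τ' ∉ T := fun hmem ↦ absurd (hτsmax hmem) (not_le.2 hτ'gt)
    obtain ⟨y, hy⟩ := H1 τ'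
    rw [dist_comm] at hy
    have hPy : ¬ P y := fun hPy ↦ hτ'T ⟨y, ⟨hτsa.trans hτ'gt.le, hτ'le⟩, hPy, hy⟩
    refine ⟨x, hPK x y hPx hPy (diam_le_of_step ha hx hy ?_), τs, ⟨hτsa, hτsb⟩, hx⟩
    rw [dist_comm]
    exact (hδb τ' hτ'dist).le

end Shadows

/-! ## The key lemma: no far backtrack -/

/-- **No far backtrack of shadows** (registered helper of stub S9; the key lemma of `NoNeckRigidity` with the
constant `10 θ + 4 ε + 4 ζ`; neck-freeness hypotheses written out, definitionally `NeckFree r θ a`,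
`NeckFree r θ b`).  See the module docstring for the statement in words and the proof. -/
theorem diam_image_Icc_le_of_backtrack : ∀ (a b : Curve ℂ) (r θ ζ ε : ℝ), 2 * ε < r → 0 ≤ ζ → (∀ s t : unitInterval, dist (a s) (a t) ≤ r → Metric.diam (a '' Set.uIcc s t) ≤ θ) → (∀ s t : unitInterval, dist (b s) (b t) ≤ r → Metric.diam (b '' Set.uIcc s t) ≤ θ) → (∀ t, ∃ s, dist (b t) (a s) ≤ ε) → (∀ s, (∃ t, dist (a s) (b t) ≤ ε) ∨ dist (a s) (a 0) ≤ ζ ∨ dist (a s) (a 1) ≤ ζ) → (∃ s₀, dist (b 0) (a s₀) ≤ ε ∧ Metric.diam (a '' Set.Icc 0 s₀) ≤ θ) → ∀ t₁ t₂ p q : unitInterval, t₁ ≤ t₂ → dist (a p) (b t₁) ≤ ε → dist (a q) (b t₂) ≤ ε → q ≤ p → Metric.diam (a '' Set.Icc q p) ≤ 10 * θ + 4 * ε + 4 * ζ := by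
  intro a b r θ ζ ε hr hζ ha hb H1 H2 A0 t₁ t₂ p q ht hp hq hqp
  obtain ⟨α₀, hα₀, hA0⟩ := A0
  have hε : 0 ≤ ε := dist_nonneg.trans hp
  have hθ : 0 ≤ θ := diam_nonneg.trans hA0
  by_contra hcon
  push Not at hcon
  -- a point `a s` of the arc far from `a p`, `a q`, `a 0`, `a 1`
  obtain ⟨s, hs, hfp, hfq, hf0, hf1⟩ := exists_far_of_lt_diam a (p := q) (q := p) (a p) (a q) (a 0) (a 1)
    (ρ₁ := 2 * θ + 2 * ε) (ρ₂ := θ) (ρ₃ := θ + ζ) (ρ₄ := θ + ζ)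
    (by positivity) hθ (by positivity) (by positivity) (by rw [uIcc_of_le hqp]; linarith)
  rw [uIcc_of_le hqp] at hs
  have hsp : s < p := lt_of_le_of_ne hs.2 fun h ↦ by rw [h, dist_self] at hfp; linarith
  have hqs : q < s := lt_of_le_of_ne hs.1 fun h ↦ by rw [← h, dist_self] at hfq; linarith
  have hα₀s : α₀ ≤ s := by
    by_contra h
    push Not at h
    have : dist (a s) (a 0) ≤ θ :=
      (dist_le_diam_image a (S := Icc 0 α₀) ⟨bot_le, h.le⟩ ⟨le_rfl, bot_le⟩).trans hA0
    linarith
  -- the interval `K` around `s`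
  set K : Set unitInterval := {k | diam (a '' uIcc s k) ≤ θ} with hKdef
  have hKs : ∀ k ∈ K, dist (a k) (a s) ≤ θ := fun k hk ↦
    (dist_le_diam_image a right_mem_uIcc left_mem_uIcc).trans hk
  have hKconn : IsPreconnected K := by
    refine Set.OrdConnected.isPreconnected ⟨fun k₁ hk₁ k₂ hk₂ z hz ↦ ?_⟩
    show diam (a '' uIcc s z) ≤ θ
    rcases le_total s z with hsz | hzs
    · refine (diam_image_mono a (uIcc_subset_uIcc left_mem_uIcc ?_)).trans hk₂
      exact mem_uIcc.2 (Or.inl ⟨hsz, hz.2⟩)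
    · refine (diam_image_mono a (uIcc_subset_uIcc left_mem_uIcc ?_)).trans hk₁
      exact mem_uIcc.2 (Or.inr ⟨hz.1, hzs⟩)
  -- the two closed classes: visited at a time `≤ t₁` / at a time `≥ t₁`
  set Bef : Set unitInterval :=
    {k | ∃ τ, (k, τ) ∈ {w : unitInterval × unitInterval | w.2 ≤ t₁ ∧ dist (a w.1) (b w.2) ≤ ε}} with hBef
  set Aft : Set unitInterval :=
    {k | ∃ τ, (k, τ) ∈ {w : unitInterval × unitInterval | t₁ ≤ w.2 ∧ dist (a w.1) (b w.2) ≤ ε}} with hAft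
  have hBefc : IsClosed Bef := isClosed_setOf_exists_mem
    ((isClosed_le continuous_snd continuous_const).inter
      (isClosed_le (continuous_dist_pair a b) continuous_const))
  have hAftc : IsClosed Aft := isClosed_setOf_exists_mem
    ((isClosed_le continuous_const continuous_snd).inter
      (isClosed_le (continuous_dist_pair a b) continuous_const))
  -- they cover `K` (H2: points of `K` are far from `a 0`, `a 1`)
  have hcover : K ⊆ Bef ∪ Aft := by
    intro k hk
    have hks := hKs k hk
    rcases H2 k with ⟨τ, hτ⟩ | h | h
    · rcases le_total τ t₁ with hτt | hτt
      · exact Or.inl ⟨τ, hτt, hτ⟩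
      · exact Or.inr ⟨τ, hτt, hτ⟩
    · have := dist_triangle (a s) (a k) (a 0)
      rw [dist_comm (a s) (a k)] at this
      linarith
    · have := dist_triangle (a s) (a k) (a 1)
      rw [dist_comm (a s) (a k)] at this
      linarith
  -- and are disjoint on `K` (else `b t₁`, hence `a p`, is close to `a s`)
  have hsep : ∀ k ∈ K, k ∈ Bef → k ∈ Aft → False := by
    rintro k hk ⟨τ, hτ, hkτ⟩ ⟨τ', hτ', hkτ'⟩
    have hbb : diam (b '' uIcc τ τ') ≤ θ := by
      refine hb τ τ' ?_
      calc dist (b τ) (b τ') ≤ dist (b τ) (a k) + dist (a k) (b τ') := dist_triangle _ _ _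
        _ ≤ ε + ε := by rw [dist_comm] at hkτ; gcongr
        _ ≤ r := by linarith
    have ht₁mem : t₁ ∈ uIcc τ τ' := by
      rw [uIcc_of_le (hτ.trans hτ')]
      exact ⟨hτ, hτ'⟩
    have h1 : dist (b τ) (b t₁) ≤ θ :=
      (dist_le_diam_of_mem ((isCompact_range b.continuous).isBounded.subset (image_subset_range _ _))
        (mem_image_of_mem _ left_mem_uIcc) (mem_image_of_mem _ ht₁mem)).trans hbb
    have h2 := dist_triangle4 (a s) (a k) (b τ) (b t₁)
    have h3 := dist_triangle (a s) (b t₁) (a p)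
    have hks := hKs k hk
    rw [dist_comm] at hks hp
    linarith
  -- both classes meet `K`: chains `α₀ ↝ p` over `[0, t₁]` and `p ↝ q` over `[t₁, t₂]`
  have hPK₁ : ∀ x y : unitInterval, x ≤ s → ¬ y ≤ s → diam (a '' uIcc x y) ≤ θ → x ∈ K := by
    intro x y hx hy hxy
    show diam (a '' uIcc s x) ≤ θ
    refine (diam_image_mono a (uIcc_subset_uIcc ?_ left_mem_uIcc)).trans hxy
    exact mem_uIcc.2 (Or.inl ⟨hx, (not_le.1 hy).le⟩)
  have hPK₂ : ∀ x y : unitInterval, s ≤ x → ¬ s ≤ y → diam (a '' uIcc x y) ≤ θ → x ∈ K := by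
    intro x y hx hy hxy
    show diam (a '' uIcc s x) ≤ θ
    refine (diam_image_mono a (uIcc_subset_uIcc ?_ left_mem_uIcc)).trans hxy
    exact mem_uIcc.2 (Or.inr ⟨(not_le.1 hy).le, hx⟩)
  rw [dist_comm] at hα₀
  obtain ⟨x, hxK, τ, hτ, hxτ⟩ := exists_mem_of_chain hr ha H1 (fun x ↦ x ≤ s) isClosed_Iic K hPK₁
    (bot_le : (0 : unitInterval) ≤ t₁) hα₀ hα₀s hp (not_le.2 hsp)
  obtain ⟨x', hx'K, τ', hτ', hx'τ'⟩ := exists_mem_of_chain hr ha H1 (fun x ↦ s ≤ x) isClosed_Ici K hPK₂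
    ht hp hsp.le hq (not_le.2 hqs)
  obtain ⟨k, hkK, hkB, hkA⟩ := isPreconnected_closed_iff.1 hKconn Bef Aft hBefc hAftc hcover
    ⟨x, hxK, τ, hτ.2, hxτ⟩ ⟨x', hx'K, τ', hτ'.1, hx'τ'⟩
  exact hsep k hkK hkB hkA

end Summit.CriticalPhenomena.CardyFormulaZ2.Cruxes.NestingRigidity.PinchResampling

end
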